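import Summits.QuantumFields.YangMills.Theorems.CovariantDischargeSweepSharpQuadraticCost
import HarnessLib

/-!
# Line «sandwich_discharge» on crux `HistoryTailL` (stmt-QuantumFields-19936), stub `stub_sandwichSweepGapCapped` — remainder (r2),
# matrix route: THE LINEARISED TWISTED COBOUNDARY OF A COVARIANTLY FRAMED SWEEP is the framed circulation plus a frame defect

Cell `ym3-torus` (YM ladder rung R3 = continuum SU(2) Yang–Mills on the three-torus — a RUNG, NOT the Clay problem: not d = 4, not
infinite volume, not a mass gap), width seat `ym-ust-19936-w5` gen 14, helper letters `--supports stmt-QuantumFields-19936`.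

The B1′ letter of the capped sweep stub (✓`CovariantDischargeSweepSharpQuadraticCost.lin_sub_sharp_le_wilsonAction4_sub_mulField`, over
✓`CovariantDischargeSweepActionVariation`) expands the action change of a left sweep `W ↦ E·W` in `SU(N)` through the LINEARISED TWISTED
COBOUNDARY `linCobd E W p = (E₁−1) + T₁(E₂−1)T₁⁻¹ + T₃(E₃⁻¹−1)T₃⁻¹ + T₄(E₄⁻¹−1)T₄⁻¹` (`T₁ = W₁`, `T₃ = W₁W₂W₃⁻¹`, `T₄ = W(∂p)`), and its
header leaves open «the frame bookkeeping of the capped stub»: bounding `linCobd_p` by the circulation `(da)_p` of the amplitude for a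
COVARIANTLY FRAMED sweep (px8 g6 `ARCH-SPRIME` §6 (r2)).  THIS FILE is that bookkeeping in the matrix model, for GENERIC `SU(N)`:

* §1 conjugation letters in the `L²`-operator norm: `‖G Y G⁻¹‖ = ‖Y‖`, ★`‖g X g⁻¹ − X‖ ≤ 2·dist1 g·‖X‖`, and for two frame transports
  `K, G` of the same Lie-algebra element ★`‖K X K⁻¹ − G X G⁻¹‖ ≤ 2·dist1(G⁻¹K)·‖X‖`.
* §2 ★★★`norm_linCobd_sub_conj_le` — if the sweep factors are framed to first order, `‖Eᵢ − 1 − GᵢZᵢGᵢ⁻¹‖ ≤ qᵢ` (`i = 1,2`) and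
  `‖Eᵢ⁻¹ − 1 + GᵢZᵢGᵢ⁻¹‖ ≤ qᵢ` (`i = 3,4`) with frame transports `Gᵢ ∈ SU(N)` at the sources of the four letters and centre-frame elements
  `Zᵢ` (for the one-axis sweep: `Zᵢ = cᵢ•X₀`), then
  `‖linCobd E W p − G₁(Z₁ + Z₂ − Z₃ − Z₄)G₁⁻¹‖ ≤ Σqᵢ + 2(‖Z₂‖·dist1(G₁⁻¹W₁G₂) + ‖Z₃‖·dist1(G₁⁻¹T₃G₃) + ‖Z₄‖·dist1(G₁⁻¹T₄G₄))`
  — the linear statistic is the FRAMED CIRCULATION `G₁(Z₁+Z₂−Z₃−Z₄)G₁⁻¹` (`= (c₁+c₂−c₃−c₄)•G₁X₀G₁⁻¹ = −s·(da)_p·X` for the one-axis sweep)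
  up to the three FRAME LOOPS `G₁⁻¹W₁G₂`, `G₁⁻¹T₃G₃`, `G₁⁻¹T₄G₄` (for tree/comb frames `Gᵧ = W(γ_{y→c})`: the two lassos and `∂p` itself),
  and the norm corollary `norm_linCobd_le_framed` (`‖linCobd_p‖ ≤ ‖Z₁+Z₂−Z₃−Z₄‖ + defect`) that B1′'s sharp cost consumes.
* §3 the pairing: `|Λ_p − Re tr(G₁(Z₁+Z₂−Z₃−Z₄)G₁⁻¹·(W(∂p) − 1))/N| ≤ defect·dist1 W(∂p)` (`abs_lin_sub_framed_pairing_le`), and the reading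
  covariance `Re tr(G Z G⁻¹·(W − 1))/N = Re tr(Z·(G⁻¹WG − 1))/N`.

The group-level twin (quaternion route over ✓`CovariantDischargePlaquetteTransport`) is `CovariantDischargeFramedPlaquetteTransport`.
WHAT THIS IS NOT.  Per-plaquette matrix algebra: no profile, no tree, no sum over plaquettes, no choice of `η_R`; nothing of
`stub_sandwichSweepGapCapped`, `HistoryTailL`, the rung R3, d = 4, a continuum limit or a mass gap is proved.  YM₃ on T³ is rung R3, NOT Clay.

References: T. Bałaban, CMP **98** (1985) 17–51 [Balaban1985Averaging] ((19)–(20) p.21: operator norm, `|Re tr X| ≤ |X|`, gauge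
transformations (8) p.19); CMP **109** (1987) 249–301 [Balaban1987RG1] ((0.2) p.252).  Elementary matrix algebra ([folklore]).
-/

noncomputable section

open scoped Matrix.Norms.L2Operator

namespace Summit.QuantumFields.YangMills.Theorems.CovariantDischargeFramedSweepLinCobd

open Literature.MathematicalPhysics.QuantumFieldTheory.Balaban1983to89
open Literature.MathematicalPhysics.QuantumFieldTheory.Balaban1983to89.UnitaryModel (nReTr norm_of_mem_unitaryGroup)
open Summit.QuantumFields.YangMills.Theorems.ApproxLift (linCobd)
open Summit.QuantumFields.YangMills.Theorems.CovariantDischargeSweepActionVariation (abs_nReTr_mul_sub_one_le)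

variable {N : Type*} [Fintype N] [DecidableEq N] [Nonempty N]

/-! ## §1 Conjugation letters in the `L²`-operator norm -/

omit [Nonempty N] in
/-- `↑(g h) = ↑g ↑h` for `SU(N)` matrices. [folklore] -/
private theorem coe_mul' (g h : Matrix.specialUnitaryGroup N ℂ) :
    ((g * h : Matrix.specialUnitaryGroup N ℂ) : Matrix N N ℂ) = (g : Matrix N N ℂ) * (h : Matrix N N ℂ) := rfl

omit [Nonempty N] in
/-- `↑T ↑T⁻¹ = 1`. [folklore] -/
private theorem coe_mul_coe_inv (T : Matrix.specialUnitaryGroup N ℂ) :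
    (T : Matrix N N ℂ) * ((T⁻¹ : Matrix.specialUnitaryGroup N ℂ) : Matrix N N ℂ) = 1 := by
  rw [← coe_mul', mul_inv_cancel]; rfl

omit [Nonempty N] in
/-- `↑T⁻¹ ↑T = 1`. [folklore] -/
private theorem coe_inv_mul_coe (T : Matrix.specialUnitaryGroup N ℂ) :
    ((T⁻¹ : Matrix.specialUnitaryGroup N ℂ) : Matrix N N ℂ) * (T : Matrix N N ℂ) = 1 := by
  rw [← coe_mul', inv_mul_cancel]; rfl

/-- An `SU(N)` matrix has operator norm `1`. [cite: Balaban1985Averaging, (19) p.21] -/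
theorem norm_coe_eq_one (T : Matrix.specialUnitaryGroup N ℂ) : ‖(T : Matrix N N ℂ)‖ = 1 :=
  norm_of_mem_unitaryGroup (Matrix.specialUnitaryGroup_le_unitaryGroup T.2)

/-- `dist1 g = ‖↑g − 1‖` in the cell's `SU(N)` instance (definitional). [cite: Balaban1985Averaging, (19) p.21] -/
theorem dist1_eq_norm_coe_sub_one (g : Matrix.specialUnitaryGroup N ℂ) : dist1 g = ‖(g : Matrix N N ℂ) - 1‖ := rfl

/-- CONJUGATION IS AN ISOMETRY: `‖G Y G⁻¹‖ = ‖Y‖` for `G ∈ SU(N)` and any matrix `Y`. [cite: Balaban1985Averaging, (19) p.21] -/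
theorem norm_conj_eq (G : Matrix.specialUnitaryGroup N ℂ) (Y : Matrix N N ℂ) :
    ‖(G : Matrix N N ℂ) * Y * ((G⁻¹ : Matrix.specialUnitaryGroup N ℂ) : Matrix N N ℂ)‖ = ‖Y‖ := by
  have key : ∀ (H : Matrix.specialUnitaryGroup N ℂ) (X : Matrix N N ℂ),
      ‖(H : Matrix N N ℂ) * X * ((H⁻¹ : Matrix.specialUnitaryGroup N ℂ) : Matrix N N ℂ)‖ ≤ ‖X‖ := by
    intro H X
    calc ‖(H : Matrix N N ℂ) * X * ((H⁻¹ : Matrix.specialUnitaryGroup N ℂ) : Matrix N N ℂ)‖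
        ≤ ‖(H : Matrix N N ℂ) * X‖ * ‖((H⁻¹ : Matrix.specialUnitaryGroup N ℂ) : Matrix N N ℂ)‖ := Matrix.l2_opNorm_mul _ _
      _ ≤ (‖(H : Matrix N N ℂ)‖ * ‖X‖) * ‖((H⁻¹ : Matrix.specialUnitaryGroup N ℂ) : Matrix N N ℂ)‖ := by
          gcongr; exact Matrix.l2_opNorm_mul _ _
      _ = ‖X‖ := by rw [norm_coe_eq_one, norm_coe_eq_one, one_mul, mul_one]
  refine le_antisymm (key G Y) ?_
  have e : ((G⁻¹ : Matrix.specialUnitaryGroup N ℂ) : Matrix N N ℂ) *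
      ((G : Matrix N N ℂ) * Y * ((G⁻¹ : Matrix.specialUnitaryGroup N ℂ) : Matrix N N ℂ)) *
      (((G⁻¹)⁻¹ : Matrix.specialUnitaryGroup N ℂ) : Matrix N N ℂ) = Y := by
    rw [inv_inv]
    calc _ = (((G⁻¹ : Matrix.specialUnitaryGroup N ℂ) : Matrix N N ℂ) * (G : Matrix N N ℂ)) * Y *
          (((G⁻¹ : Matrix.specialUnitaryGroup N ℂ) : Matrix N N ℂ) * (G : Matrix N N ℂ)) := by noncomm_ring
      _ = Y := by rw [coe_inv_mul_coe, one_mul, mul_one]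
  calc ‖Y‖ = ‖((G⁻¹ : Matrix.specialUnitaryGroup N ℂ) : Matrix N N ℂ) *
      ((G : Matrix N N ℂ) * Y * ((G⁻¹ : Matrix.specialUnitaryGroup N ℂ) : Matrix N N ℂ)) *
      (((G⁻¹)⁻¹ : Matrix.specialUnitaryGroup N ℂ) : Matrix N N ℂ)‖ := by rw [e]
    _ ≤ _ := key G⁻¹ _

/-- ★ **ADJOINT ACTION NEAR THE IDENTITY**: `‖g X g⁻¹ − X‖ ≤ 2·dist1 g·‖X‖`
(`g X g⁻¹ − X = (g − 1) X g⁻¹ + X (g⁻¹ − 1)`, `dist1 g⁻¹ = dist1 g`). [cite: Balaban1985Averaging, (19) p.21] -/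
theorem norm_conj_sub_self_le (g : Matrix.specialUnitaryGroup N ℂ) (X : Matrix N N ℂ) :
    ‖(g : Matrix N N ℂ) * X * ((g⁻¹ : Matrix.specialUnitaryGroup N ℂ) : Matrix N N ℂ) - X‖ ≤ 2 * dist1 g * ‖X‖ := by
  have e : (g : Matrix N N ℂ) * X * ((g⁻¹ : Matrix.specialUnitaryGroup N ℂ) : Matrix N N ℂ) - X =
      ((g : Matrix N N ℂ) - 1) * X * ((g⁻¹ : Matrix.specialUnitaryGroup N ℂ) : Matrix N N ℂ) +
        X * (((g⁻¹ : Matrix.specialUnitaryGroup N ℂ) : Matrix N N ℂ) - 1) := by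
    noncomm_ring
  rw [e]
  have hg : dist1 g = ‖(g : Matrix N N ℂ) - 1‖ := rfl
  have hgi : dist1 g = ‖((g⁻¹ : Matrix.specialUnitaryGroup N ℂ) : Matrix N N ℂ) - 1‖ := by
    rw [← GaugeGroup.dist1_inv]; rfl
  calc _ ≤ ‖((g : Matrix N N ℂ) - 1) * X * ((g⁻¹ : Matrix.specialUnitaryGroup N ℂ) : Matrix N N ℂ)‖ +
        ‖X * (((g⁻¹ : Matrix.specialUnitaryGroup N ℂ) : Matrix N N ℂ) - 1)‖ := norm_add_le _ _
    _ ≤ ‖((g : Matrix N N ℂ) - 1) * X‖ * ‖((g⁻¹ : Matrix.specialUnitaryGroup N ℂ) : Matrix N N ℂ)‖ +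
        ‖X‖ * ‖((g⁻¹ : Matrix.specialUnitaryGroup N ℂ) : Matrix N N ℂ) - 1‖ :=
          add_le_add (Matrix.l2_opNorm_mul _ _) (Matrix.l2_opNorm_mul _ _)
    _ ≤ (‖(g : Matrix N N ℂ) - 1‖ * ‖X‖) * ‖((g⁻¹ : Matrix.specialUnitaryGroup N ℂ) : Matrix N N ℂ)‖ +
        ‖X‖ * ‖((g⁻¹ : Matrix.specialUnitaryGroup N ℂ) : Matrix N N ℂ) - 1‖ := by
          gcongr; exact Matrix.l2_opNorm_mul _ _
    _ = 2 * dist1 g * ‖X‖ := by rw [norm_coe_eq_one, ← hg, ← hgi]; ring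

/-- ★ **TWO FRAME TRANSPORTS OF ONE ELEMENT**: `‖K X K⁻¹ − G X G⁻¹‖ ≤ 2·dist1(G⁻¹K)·‖X‖`
(`K X K⁻¹ − G X G⁻¹ = G·((G⁻¹K) X (G⁻¹K)⁻¹ − X)·G⁻¹` and §1). [cite: Balaban1985Averaging, (19) p.21] -/
theorem norm_conj_sub_conj_le (K G : Matrix.specialUnitaryGroup N ℂ) (X : Matrix N N ℂ) :
    ‖(K : Matrix N N ℂ) * X * ((K⁻¹ : Matrix.specialUnitaryGroup N ℂ) : Matrix N N ℂ) -
        (G : Matrix N N ℂ) * X * ((G⁻¹ : Matrix.specialUnitaryGroup N ℂ) : Matrix N N ℂ)‖ ≤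
      2 * dist1 (G⁻¹ * K) * ‖X‖ := by
  have e1 : (G : Matrix N N ℂ) * ((G⁻¹ * K : Matrix.specialUnitaryGroup N ℂ) : Matrix N N ℂ) = (K : Matrix N N ℂ) := by
    rw [← coe_mul', mul_inv_cancel_left]
  have e2 : (((G⁻¹ * K)⁻¹ : Matrix.specialUnitaryGroup N ℂ) : Matrix N N ℂ) * ((G⁻¹ : Matrix.specialUnitaryGroup N ℂ) : Matrix N N ℂ) =
      ((K⁻¹ : Matrix.specialUnitaryGroup N ℂ) : Matrix N N ℂ) := by
    rw [← coe_mul', mul_inv_rev, inv_inv, mul_inv_cancel_right]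
  have e : (K : Matrix N N ℂ) * X * ((K⁻¹ : Matrix.specialUnitaryGroup N ℂ) : Matrix N N ℂ) -
      (G : Matrix N N ℂ) * X * ((G⁻¹ : Matrix.specialUnitaryGroup N ℂ) : Matrix N N ℂ) =
      (G : Matrix N N ℂ) * (((G⁻¹ * K : Matrix.specialUnitaryGroup N ℂ) : Matrix N N ℂ) * X *
        (((G⁻¹ * K)⁻¹ : Matrix.specialUnitaryGroup N ℂ) : Matrix N N ℂ) - X) *
        ((G⁻¹ : Matrix.specialUnitaryGroup N ℂ) : Matrix N N ℂ) := by
    have h : (G : Matrix N N ℂ) * (((G⁻¹ * K : Matrix.specialUnitaryGroup N ℂ) : Matrix N N ℂ) * X *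
        (((G⁻¹ * K)⁻¹ : Matrix.specialUnitaryGroup N ℂ) : Matrix N N ℂ) - X) *
        ((G⁻¹ : Matrix.specialUnitaryGroup N ℂ) : Matrix N N ℂ) =
        ((G : Matrix N N ℂ) * ((G⁻¹ * K : Matrix.specialUnitaryGroup N ℂ) : Matrix N N ℂ)) * X *
          ((((G⁻¹ * K)⁻¹ : Matrix.specialUnitaryGroup N ℂ) : Matrix N N ℂ) * ((G⁻¹ : Matrix.specialUnitaryGroup N ℂ) : Matrix N N ℂ)) -
          (G : Matrix N N ℂ) * X * ((G⁻¹ : Matrix.specialUnitaryGroup N ℂ) : Matrix N N ℂ) := by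
      noncomm_ring
    rw [h, e1, e2]
  rw [e, norm_conj_eq]
  exact norm_conj_sub_self_le _ _

/-! ## §2 The linearised twisted coboundary of a framed sweep -/

section Framed

variable {P : Params} {j : ℕ}

omit [Nonempty N] in
/-- Transport of a framed first-order factor: `T D T⁻¹ − G₁ZG₁⁻¹ = T(D − GZG⁻¹)T⁻¹ + ((TG)Z(TG)⁻¹ − G₁ZG₁⁻¹)`. [folklore] -/
private theorem transport_framed_eq (T G₀ G₁ : Matrix.specialUnitaryGroup N ℂ) (D Z : Matrix N N ℂ) :
    (T : Matrix N N ℂ) * D * ((T⁻¹ : Matrix.specialUnitaryGroup N ℂ) : Matrix N N ℂ) -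
        (G₁ : Matrix N N ℂ) * Z * ((G₁⁻¹ : Matrix.specialUnitaryGroup N ℂ) : Matrix N N ℂ) =
      (T : Matrix N N ℂ) * (D - (G₀ : Matrix N N ℂ) * Z * ((G₀⁻¹ : Matrix.specialUnitaryGroup N ℂ) : Matrix N N ℂ)) *
          ((T⁻¹ : Matrix.specialUnitaryGroup N ℂ) : Matrix N N ℂ) +
        (((T * G₀ : Matrix.specialUnitaryGroup N ℂ) : Matrix N N ℂ) * Z * (((T * G₀)⁻¹ : Matrix.specialUnitaryGroup N ℂ) : Matrix N N ℂ) -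
          (G₁ : Matrix N N ℂ) * Z * ((G₁⁻¹ : Matrix.specialUnitaryGroup N ℂ) : Matrix N N ℂ)) := by
  rw [mul_inv_rev, coe_mul', coe_mul']
  noncomm_ring

/-- Norm of a transported framed factor: `‖T(E − 1)T⁻¹ ∓ G₁ZG₁⁻¹‖ ≤ ‖E − 1 ∓ GZG⁻¹‖ + 2·dist1(G₁⁻¹TG)·‖Z‖`. [cite: Balaban1985Averaging, (19) p.21] -/
theorem norm_transport_sub_framed_le (T G₀ G₁ : Matrix.specialUnitaryGroup N ℂ) (D Z : Matrix N N ℂ) :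
    ‖(T : Matrix N N ℂ) * D * ((T⁻¹ : Matrix.specialUnitaryGroup N ℂ) : Matrix N N ℂ) -
        (G₁ : Matrix N N ℂ) * Z * ((G₁⁻¹ : Matrix.specialUnitaryGroup N ℂ) : Matrix N N ℂ)‖ ≤
      ‖D - (G₀ : Matrix N N ℂ) * Z * ((G₀⁻¹ : Matrix.specialUnitaryGroup N ℂ) : Matrix N N ℂ)‖ +
        2 * dist1 (G₁⁻¹ * (T * G₀)) * ‖Z‖ := by
  rw [transport_framed_eq T G₀ G₁ D Z]
  refine (norm_add_le _ _).trans (add_le_add ?_ (norm_conj_sub_conj_le _ _ _))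
  rw [norm_conj_eq]

/-- ★★★ **THE LINEARISED TWISTED COBOUNDARY OF A FRAMED SWEEP.**  Let the sweep factors on the four letters of `∂p` be framed to first
order — `‖E₁ − 1 − G₁Z₁G₁⁻¹‖ ≤ q₁`, `‖E₂ − 1 − G₂Z₂G₂⁻¹‖ ≤ q₂`, `‖E₃⁻¹ − 1 + G₃Z₃G₃⁻¹‖ ≤ q₃`, `‖E₄⁻¹ − 1 + G₄Z₄G₄⁻¹‖ ≤ q₄` (frame
transports `Gᵢ ∈ SU(N)` at the letters' sources, centre-frame elements `Zᵢ`; for the one-axis sweep `Eᵢ = exp(cᵢ·GᵢX₀Gᵢ⁻¹)`,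
`Zᵢ = cᵢ•X₀`, `qᵢ = O(cᵢ²)`).  Then `linCobd E W p` is the FRAMED CIRCULATION `G₁(Z₁ + Z₂ − Z₃ − Z₄)G₁⁻¹` up to
`Σqᵢ + 2(‖Z₂‖·dist1(G₁⁻¹W₁G₂) + ‖Z₃‖·dist1(G₁⁻¹(W₁W₂W₃⁻¹)G₃) + ‖Z₄‖·dist1(G₁⁻¹W(∂p)G₄))` — the three FRAME LOOPS.
[cite: Balaban1985Averaging, (19)-(20) p.21; Balaban1987RG1, (0.2) p.252] -/
theorem norm_linCobd_sub_conj_le (E W : GaugeField P j (Matrix.specialUnitaryGroup N ℂ)) (p : Plaq P j)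
    (G₁ G₂ G₃ G₄ : Matrix.specialUnitaryGroup N ℂ) (Z₁ Z₂ Z₃ Z₄ : Matrix N N ℂ) {q₁ q₂ q₃ q₄ : ℝ}
    (h₁ : ‖((E ⟨p.src, p.μ⟩ : Matrix.specialUnitaryGroup N ℂ) : Matrix N N ℂ) - 1 -
      (G₁ : Matrix N N ℂ) * Z₁ * ((G₁⁻¹ : Matrix.specialUnitaryGroup N ℂ) : Matrix N N ℂ)‖ ≤ q₁)
    (h₂ : ‖((E ⟨p.src.shift p.μ, p.ν⟩ : Matrix.specialUnitaryGroup N ℂ) : Matrix N N ℂ) - 1 -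
      (G₂ : Matrix N N ℂ) * Z₂ * ((G₂⁻¹ : Matrix.specialUnitaryGroup N ℂ) : Matrix N N ℂ)‖ ≤ q₂)
    (h₃ : ‖(((E ⟨p.src.shift p.ν, p.μ⟩)⁻¹ : Matrix.specialUnitaryGroup N ℂ) : Matrix N N ℂ) - 1 +
      (G₃ : Matrix N N ℂ) * Z₃ * ((G₃⁻¹ : Matrix.specialUnitaryGroup N ℂ) : Matrix N N ℂ)‖ ≤ q₃)
    (h₄ : ‖(((E ⟨p.src, p.ν⟩)⁻¹ : Matrix.specialUnitaryGroup N ℂ) : Matrix N N ℂ) - 1 +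
      (G₄ : Matrix N N ℂ) * Z₄ * ((G₄⁻¹ : Matrix.specialUnitaryGroup N ℂ) : Matrix N N ℂ)‖ ≤ q₄) :
    ‖linCobd E W p - (G₁ : Matrix N N ℂ) * (Z₁ + Z₂ - Z₃ - Z₄) * ((G₁⁻¹ : Matrix.specialUnitaryGroup N ℂ) : Matrix N N ℂ)‖ ≤
      (q₁ + q₂ + q₃ + q₄) +
        2 * (‖Z₂‖ * dist1 (G₁⁻¹ * W ⟨p.src, p.μ⟩ * G₂) +
          ‖Z₃‖ * dist1 (G₁⁻¹ * (W ⟨p.src, p.μ⟩ * W ⟨p.src.shift p.μ, p.ν⟩ * (W ⟨p.src.shift p.ν, p.μ⟩)⁻¹) * G₃) +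
          ‖Z₄‖ * dist1 (G₁⁻¹ * GaugeField.plaqHol W p * G₄)) := by
  -- names
  set T₁ : Matrix.specialUnitaryGroup N ℂ := W ⟨p.src, p.μ⟩ with hT₁
  set T₃ : Matrix.specialUnitaryGroup N ℂ := W ⟨p.src, p.μ⟩ * W ⟨p.src.shift p.μ, p.ν⟩ * (W ⟨p.src.shift p.ν, p.μ⟩)⁻¹ with hT₃
  set T₄ : Matrix.specialUnitaryGroup N ℂ := GaugeField.plaqHol W p with hT₄
  set D₁ : Matrix N N ℂ := ((E ⟨p.src, p.μ⟩ : Matrix.specialUnitaryGroup N ℂ) : Matrix N N ℂ) - 1 with hD₁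
  set D₂ : Matrix N N ℂ := ((E ⟨p.src.shift p.μ, p.ν⟩ : Matrix.specialUnitaryGroup N ℂ) : Matrix N N ℂ) - 1 with hD₂
  set D₃ : Matrix N N ℂ := (((E ⟨p.src.shift p.ν, p.μ⟩)⁻¹ : Matrix.specialUnitaryGroup N ℂ) : Matrix N N ℂ) - 1 with hD₃
  set D₄ : Matrix N N ℂ := (((E ⟨p.src, p.ν⟩)⁻¹ : Matrix.specialUnitaryGroup N ℂ) : Matrix N N ℂ) - 1 with hD₄
  set F : Matrix N N ℂ → Matrix N N ℂ := fun Z =>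
    (G₁ : Matrix N N ℂ) * Z * ((G₁⁻¹ : Matrix.specialUnitaryGroup N ℂ) : Matrix N N ℂ) with hF
  have hlin : linCobd E W p = D₁ +
      (T₁ : Matrix N N ℂ) * D₂ * ((T₁⁻¹ : Matrix.specialUnitaryGroup N ℂ) : Matrix N N ℂ) +
      (T₃ : Matrix N N ℂ) * D₃ * ((T₃⁻¹ : Matrix.specialUnitaryGroup N ℂ) : Matrix N N ℂ) +
      (T₄ : Matrix N N ℂ) * D₄ * ((T₄⁻¹ : Matrix.specialUnitaryGroup N ℂ) : Matrix N N ℂ) := rfl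
  have hsplit : linCobd E W p - (G₁ : Matrix N N ℂ) * (Z₁ + Z₂ - Z₃ - Z₄) * ((G₁⁻¹ : Matrix.specialUnitaryGroup N ℂ) : Matrix N N ℂ) =
      (D₁ - F Z₁) +
      ((T₁ : Matrix N N ℂ) * D₂ * ((T₁⁻¹ : Matrix.specialUnitaryGroup N ℂ) : Matrix N N ℂ) - F Z₂) +
      ((T₃ : Matrix N N ℂ) * D₃ * ((T₃⁻¹ : Matrix.specialUnitaryGroup N ℂ) : Matrix N N ℂ) - F (-Z₃)) +
      ((T₄ : Matrix N N ℂ) * D₄ * ((T₄⁻¹ : Matrix.specialUnitaryGroup N ℂ) : Matrix N N ℂ) - F (-Z₄)) := by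
    rw [hlin]
    simp only [hF]
    noncomm_ring
  rw [hsplit]
  have b₁ : ‖D₁ - F Z₁‖ ≤ q₁ := h₁
  have b₂ : ‖(T₁ : Matrix N N ℂ) * D₂ * ((T₁⁻¹ : Matrix.specialUnitaryGroup N ℂ) : Matrix N N ℂ) - F Z₂‖ ≤
      q₂ + 2 * dist1 (G₁⁻¹ * (T₁ * G₂)) * ‖Z₂‖ :=
    (norm_transport_sub_framed_le T₁ G₂ G₁ D₂ Z₂).trans (add_le_add h₂ le_rfl)
  have h₃' : ‖D₃ - (G₃ : Matrix N N ℂ) * (-Z₃) * ((G₃⁻¹ : Matrix.specialUnitaryGroup N ℂ) : Matrix N N ℂ)‖ ≤ q₃ := by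
    have e : D₃ - (G₃ : Matrix N N ℂ) * (-Z₃) * ((G₃⁻¹ : Matrix.specialUnitaryGroup N ℂ) : Matrix N N ℂ) =
        D₃ + (G₃ : Matrix N N ℂ) * Z₃ * ((G₃⁻¹ : Matrix.specialUnitaryGroup N ℂ) : Matrix N N ℂ) := by noncomm_ring
    rw [e]; exact h₃
  have h₄' : ‖D₄ - (G₄ : Matrix N N ℂ) * (-Z₄) * ((G₄⁻¹ : Matrix.specialUnitaryGroup N ℂ) : Matrix N N ℂ)‖ ≤ q₄ := by
    have e : D₄ - (G₄ : Matrix N N ℂ) * (-Z₄) * ((G₄⁻¹ : Matrix.specialUnitaryGroup N ℂ) : Matrix N N ℂ) =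
        D₄ + (G₄ : Matrix N N ℂ) * Z₄ * ((G₄⁻¹ : Matrix.specialUnitaryGroup N ℂ) : Matrix N N ℂ) := by noncomm_ring
    rw [e]; exact h₄
  have b₃ : ‖(T₃ : Matrix N N ℂ) * D₃ * ((T₃⁻¹ : Matrix.specialUnitaryGroup N ℂ) : Matrix N N ℂ) - F (-Z₃)‖ ≤
      q₃ + 2 * dist1 (G₁⁻¹ * (T₃ * G₃)) * ‖-Z₃‖ :=
    (norm_transport_sub_framed_le T₃ G₃ G₁ D₃ (-Z₃)).trans (add_le_add h₃' le_rfl)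
  have b₄ : ‖(T₄ : Matrix N N ℂ) * D₄ * ((T₄⁻¹ : Matrix.specialUnitaryGroup N ℂ) : Matrix N N ℂ) - F (-Z₄)‖ ≤
      q₄ + 2 * dist1 (G₁⁻¹ * (T₄ * G₄)) * ‖-Z₄‖ :=
    (norm_transport_sub_framed_le T₄ G₄ G₁ D₄ (-Z₄)).trans (add_le_add h₄' le_rfl)
  rw [norm_neg] at b₃ b₄
  rw [← mul_assoc] at b₂ b₃ b₄
  have s := add_le_add (add_le_add (add_le_add b₁ b₂) b₃) b₄
  refine ((norm_add_le _ _).trans (add_le_add ((norm_add_le _ _).trans (add_le_add (norm_add_le _ _) le_rfl)) le_rfl)).trans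
    (s.trans (le_of_eq ?_))
  ring

/-- The norm corollary B1′'s sharp cost consumes: `‖linCobd E W p‖ ≤ ‖Z₁ + Z₂ − Z₃ − Z₄‖ + Σqᵢ + 2(‖Z₂‖d₂ + ‖Z₃‖d₃ + ‖Z₄‖d₄)`
(the framed circulation has the norm of the centre-frame circulation). [cite: Balaban1985Averaging, (19)-(20) p.21] -/
theorem norm_linCobd_le_framed (E W : GaugeField P j (Matrix.specialUnitaryGroup N ℂ)) (p : Plaq P j)
    (G₁ G₂ G₃ G₄ : Matrix.specialUnitaryGroup N ℂ) (Z₁ Z₂ Z₃ Z₄ : Matrix N N ℂ) {q₁ q₂ q₃ q₄ : ℝ}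
    (h₁ : ‖((E ⟨p.src, p.μ⟩ : Matrix.specialUnitaryGroup N ℂ) : Matrix N N ℂ) - 1 -
      (G₁ : Matrix N N ℂ) * Z₁ * ((G₁⁻¹ : Matrix.specialUnitaryGroup N ℂ) : Matrix N N ℂ)‖ ≤ q₁)
    (h₂ : ‖((E ⟨p.src.shift p.μ, p.ν⟩ : Matrix.specialUnitaryGroup N ℂ) : Matrix N N ℂ) - 1 -
      (G₂ : Matrix N N ℂ) * Z₂ * ((G₂⁻¹ : Matrix.specialUnitaryGroup N ℂ) : Matrix N N ℂ)‖ ≤ q₂)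
    (h₃ : ‖(((E ⟨p.src.shift p.ν, p.μ⟩)⁻¹ : Matrix.specialUnitaryGroup N ℂ) : Matrix N N ℂ) - 1 +
      (G₃ : Matrix N N ℂ) * Z₃ * ((G₃⁻¹ : Matrix.specialUnitaryGroup N ℂ) : Matrix N N ℂ)‖ ≤ q₃)
    (h₄ : ‖(((E ⟨p.src, p.ν⟩)⁻¹ : Matrix.specialUnitaryGroup N ℂ) : Matrix N N ℂ) - 1 +
      (G₄ : Matrix N N ℂ) * Z₄ * ((G₄⁻¹ : Matrix.specialUnitaryGroup N ℂ) : Matrix N N ℂ)‖ ≤ q₄) :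
    ‖linCobd E W p‖ ≤ ‖Z₁ + Z₂ - Z₃ - Z₄‖ + ((q₁ + q₂ + q₃ + q₄) +
        2 * (‖Z₂‖ * dist1 (G₁⁻¹ * W ⟨p.src, p.μ⟩ * G₂) +
          ‖Z₃‖ * dist1 (G₁⁻¹ * (W ⟨p.src, p.μ⟩ * W ⟨p.src.shift p.μ, p.ν⟩ * (W ⟨p.src.shift p.ν, p.μ⟩)⁻¹) * G₃) +
          ‖Z₄‖ * dist1 (G₁⁻¹ * GaugeField.plaqHol W p * G₄))) := by
  have h := norm_linCobd_sub_conj_le E W p G₁ G₂ G₃ G₄ Z₁ Z₂ Z₃ Z₄ h₁ h₂ h₃ h₄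
  have hc : ‖(G₁ : Matrix N N ℂ) * (Z₁ + Z₂ - Z₃ - Z₄) * ((G₁⁻¹ : Matrix.specialUnitaryGroup N ℂ) : Matrix N N ℂ)‖ =
      ‖Z₁ + Z₂ - Z₃ - Z₄‖ := norm_conj_eq _ _
  have t := norm_le_norm_add_norm_sub' (linCobd E W p)
    ((G₁ : Matrix N N ℂ) * (Z₁ + Z₂ - Z₃ - Z₄) * ((G₁⁻¹ : Matrix.specialUnitaryGroup N ℂ) : Matrix N N ℂ))
  rw [hc] at t
  linarith

/-! ## §3 The pairing against the plaquette deviation and the reading covariance -/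

/-- ★ **THE LINEAR STATISTIC IS THE FRAMED PAIRING UP TO THE DEFECT**: with `Λ_p = Re tr(linCobd_p·(W(∂p) − 1))/N`,
`|Λ_p − Re tr(G₁(Z₁+Z₂−Z₃−Z₄)G₁⁻¹·(W(∂p) − 1))/N| ≤ (Σqᵢ + 2(‖Z₂‖d₂ + ‖Z₃‖d₃ + ‖Z₄‖d₄))·dist1 W(∂p)`
(✓`abs_nReTr_mul_sub_one_le`). [cite: Balaban1985Averaging, (20) p.21] -/
theorem abs_lin_sub_framed_pairing_le (E W : GaugeField P j (Matrix.specialUnitaryGroup N ℂ)) (p : Plaq P j)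
    (G₁ G₂ G₃ G₄ : Matrix.specialUnitaryGroup N ℂ) (Z₁ Z₂ Z₃ Z₄ : Matrix N N ℂ) {q₁ q₂ q₃ q₄ : ℝ}
    (h₁ : ‖((E ⟨p.src, p.μ⟩ : Matrix.specialUnitaryGroup N ℂ) : Matrix N N ℂ) - 1 -
      (G₁ : Matrix N N ℂ) * Z₁ * ((G₁⁻¹ : Matrix.specialUnitaryGroup N ℂ) : Matrix N N ℂ)‖ ≤ q₁)
    (h₂ : ‖((E ⟨p.src.shift p.μ, p.ν⟩ : Matrix.specialUnitaryGroup N ℂ) : Matrix N N ℂ) - 1 -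
      (G₂ : Matrix N N ℂ) * Z₂ * ((G₂⁻¹ : Matrix.specialUnitaryGroup N ℂ) : Matrix N N ℂ)‖ ≤ q₂)
    (h₃ : ‖(((E ⟨p.src.shift p.ν, p.μ⟩)⁻¹ : Matrix.specialUnitaryGroup N ℂ) : Matrix N N ℂ) - 1 +
      (G₃ : Matrix N N ℂ) * Z₃ * ((G₃⁻¹ : Matrix.specialUnitaryGroup N ℂ) : Matrix N N ℂ)‖ ≤ q₃)
    (h₄ : ‖(((E ⟨p.src, p.ν⟩)⁻¹ : Matrix.specialUnitaryGroup N ℂ) : Matrix N N ℂ) - 1 +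
      (G₄ : Matrix N N ℂ) * Z₄ * ((G₄⁻¹ : Matrix.specialUnitaryGroup N ℂ) : Matrix N N ℂ)‖ ≤ q₄) :
    |nReTr (linCobd E W p * (((GaugeField.plaqHol W p : Matrix.specialUnitaryGroup N ℂ) : Matrix N N ℂ) - 1)) -
        nReTr ((G₁ : Matrix N N ℂ) * (Z₁ + Z₂ - Z₃ - Z₄) * ((G₁⁻¹ : Matrix.specialUnitaryGroup N ℂ) : Matrix N N ℂ) *
          (((GaugeField.plaqHol W p : Matrix.specialUnitaryGroup N ℂ) : Matrix N N ℂ) - 1))| ≤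
      ((q₁ + q₂ + q₃ + q₄) +
        2 * (‖Z₂‖ * dist1 (G₁⁻¹ * W ⟨p.src, p.μ⟩ * G₂) +
          ‖Z₃‖ * dist1 (G₁⁻¹ * (W ⟨p.src, p.μ⟩ * W ⟨p.src.shift p.μ, p.ν⟩ * (W ⟨p.src.shift p.ν, p.μ⟩)⁻¹) * G₃) +
          ‖Z₄‖ * dist1 (G₁⁻¹ * GaugeField.plaqHol W p * G₄))) * dist1 (GaugeField.plaqHol W p) := by
  have h := norm_linCobd_sub_conj_le E W p G₁ G₂ G₃ G₄ Z₁ Z₂ Z₃ Z₄ h₁ h₂ h₃ h₄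
  rw [← T4TiltOscillation.nReTr_sub, ← sub_mul]
  exact (abs_nReTr_mul_sub_one_le _ _).trans (mul_le_mul_of_nonneg_right h (GaugeGroup.dist1_nonneg _))

omit [Nonempty N] in
/-- ★ **READING COVARIANCE** (matrix form): `Re tr(G Z G⁻¹·(W − 1))/N = Re tr(Z·(G⁻¹WG − 1))/N` — the framed pairing at `p` is the
centre-frame pairing of the plaquette transported to the centre (cyclicity of the trace). [cite: Balaban1985Averaging, (8) p.19, (20) p.21] -/
theorem nReTr_conj_mul_sub_one (G₀ W : Matrix.specialUnitaryGroup N ℂ) (Z : Matrix N N ℂ) :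
    nReTr ((G₀ : Matrix N N ℂ) * Z * ((G₀⁻¹ : Matrix.specialUnitaryGroup N ℂ) : Matrix N N ℂ) *
        ((W : Matrix N N ℂ) - 1)) =
      nReTr (Z * (((G₀⁻¹ * W * G₀ : Matrix.specialUnitaryGroup N ℂ) : Matrix N N ℂ) - 1)) := by
  have e : Z * (((G₀⁻¹ * W * G₀ : Matrix.specialUnitaryGroup N ℂ) : Matrix N N ℂ) - 1) =
      ((G₀⁻¹ : Matrix.specialUnitaryGroup N ℂ) : Matrix N N ℂ) *
        ((G₀ : Matrix N N ℂ) * Z * ((G₀⁻¹ : Matrix.specialUnitaryGroup N ℂ) : Matrix N N ℂ) * ((W : Matrix N N ℂ) - 1)) *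
        (G₀ : Matrix N N ℂ) := by
    rw [coe_mul', coe_mul']
    have h1 := coe_inv_mul_coe G₀
    calc Z * (((G₀⁻¹ : Matrix.specialUnitaryGroup N ℂ) : Matrix N N ℂ) * (W : Matrix N N ℂ) * (G₀ : Matrix N N ℂ) - 1)
        = Z * (((G₀⁻¹ : Matrix.specialUnitaryGroup N ℂ) : Matrix N N ℂ) * (W : Matrix N N ℂ) * (G₀ : Matrix N N ℂ) -
            ((G₀⁻¹ : Matrix.specialUnitaryGroup N ℂ) : Matrix N N ℂ) * (G₀ : Matrix N N ℂ)) := by rw [h1]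
      _ = (((G₀⁻¹ : Matrix.specialUnitaryGroup N ℂ) : Matrix N N ℂ) * (G₀ : Matrix N N ℂ)) * Z *
            (((G₀⁻¹ : Matrix.specialUnitaryGroup N ℂ) : Matrix N N ℂ) * (W : Matrix N N ℂ) * (G₀ : Matrix N N ℂ) -
            ((G₀⁻¹ : Matrix.specialUnitaryGroup N ℂ) : Matrix N N ℂ) * (G₀ : Matrix N N ℂ)) := by rw [h1, one_mul]
      _ = _ := by noncomm_ring
  rw [e]
  exact (UnitaryModel.nReTr_conj (coe_mul_coe_inv G₀)).symm

end Framed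

end Summit.QuantumFields.YangMills.Theorems.CovariantDischargeFramedSweepLinCobd

end
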